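import Summits.Ventures.DiscreteObjects.Hadamard.ParityCyclotomic29
import Summits.Ventures.DiscreteObjects.Hadamard.ParityPermModule29

/-!
# Even multiplicity of self-reciprocal factors for an isometry preserving a self-dual code (kernel; Lander Prop. 3.18)

Framing: lottery ticket; floor = certified bounds/negative ranges.

Cell pub-namedobj (venture DiscreteObjects), target (H), hadamard gen 15.  The representation-theoretic heart of Lander's
method (Symmetric Designs: An Algebraic Approach, 1983, Prop. 3.18 p. 94: a module with a non-degenerate invariant form and a
self-dual invariant submodule has every self-contragredient composition factor with EVEN multiplicity), in the semisimple
cyclic case and in coordinates, for use at the MATRIX level of a Hadamard matrix (`HadamardCodeModQ`,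
`HadamardSignedAutParity`):

**`two_mul_natDegree_dvd_finrank_ker`.**  Let `F` be a field, `V = ι → F` with the dot product, `T : V →ₗ V` an ISOMETRY
(`T v ⬝ T w = v ⬝ w`) with `T^N = 1`, `h h' = X^N - 1` coprime factors with `h` irreducible and SELF-RECIPROCAL
(`h ∣ h(X^{N-1})`, i.e. `α⁻¹` is a root whenever `α` is), and `C ≤ V` a `T`-invariant SELF-DUAL code
(`v ∈ C ↔ v ⊥ C`).  Then `2 · deg h ∣ dim ker h(T)`: the multiplicity of `h` in `T` is even.
Proof: `V_h = ker h(T) ⊥ V' = ker h'(T)` (adjoint of `g(T)` is `g(T^{N-1})`), `U = C ∩ V_h` satisfies `U^⊥ = U ⊕ V'`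
(the `V_h`-component of a code word is again a code word, being a polynomial in `T` applied to it), so
`dim V_h = 2 dim U`, and `deg h ∣ dim U` (`U` is a vector space over `F[X]/(h)`).
Also `isCompl_ker_aeval_of_pow_eq_one`, `aeval_dotProduct_of_isometry`, `aeval_mem_of_invariant`.
Ours (machine-checked re-derivation of a published argument in a special case); no `sorry`; reference
[cite: book:lander1983-symmetric-designs-algebraic-approach, Prop 3.18 p.94].
-/

open Polynomial Finset BigOperators Matrix

namespace Summit.Ventures.DiscreteObjects.Hadamard

section general
variable {F : Type*} [Field F] {M : Type*} [AddCommGroup M] [Module F M]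

/-- a `T`-invariant submodule is invariant under every power of `T` -/
lemma pow_mem_of_invariant (T : M →ₗ[F] M) (C : Submodule F M) (hCT : ∀ v ∈ C, T v ∈ C) (k : ℕ)
    {v : M} (hv : v ∈ C) : (T ^ k) v ∈ C := by
  induction k with
  | zero => simpa using hv
  | succ k ih => rw [pow_succ', Module.End.mul_apply]; exact hCT _ ih

/-- a `T`-invariant submodule is invariant under every polynomial in `T` -/
theorem aeval_mem_of_invariant (T : M →ₗ[F] M) (C : Submodule F M) (hCT : ∀ v ∈ C, T v ∈ C) (g : F[X])
    {v : M} (hv : v ∈ C) : aeval T g v ∈ C := by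
  rw [aeval_eq_sum_range, LinearMap.sum_apply]
  refine Submodule.sum_mem _ fun k _ => ?_
  rw [LinearMap.smul_apply]
  exact Submodule.smul_mem _ _ (pow_mem_of_invariant T C hCT k hv)

/-- kernels of complementary coprime factors of `X^N - 1` are complements when `T^N = 1` -/
theorem isCompl_ker_aeval_of_pow_eq_one (T : M →ₗ[F] M) {N : ℕ} (hTN : T ^ N = 1) {h h' : F[X]}
    (hf : h * h' = X ^ N - 1) (hcop : IsCoprime h h') :
    IsCompl (LinearMap.ker (aeval T h)) (LinearMap.ker (aeval T h')) := by
  refine ⟨disjoint_ker_aeval_of_isCoprime T hcop, ?_⟩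
  have h0 : aeval T (X ^ N - 1 : F[X]) = 0 := by
    rw [map_sub, map_pow, aeval_X, map_one, hTN, sub_self]
  rw [codisjoint_iff, sup_ker_aeval_eq_ker_aeval_mul_of_coprime T hcop, hf, h0, LinearMap.ker_zero]

/-- Bezout decomposition: with `a h + b h' = 1`, every `v` is `(b h')(T) v + (a h)(T) v`, the first summand in
`ker h(T)` and the second in `ker h'(T)`, when `(h h')(T) = 0` -/
lemma bezout_split (T : M →ₗ[F] M) {h h' a b : F[X]} (hab : a * h + b * h' = 1) (hzero : aeval T (h * h') = 0)
    (v : M) :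
    v = aeval T (b * h') v + aeval T (a * h) v ∧ aeval T (b * h') v ∈ LinearMap.ker (aeval T h) ∧
      aeval T (a * h) v ∈ LinearMap.ker (aeval T h') := by
  refine ⟨?_, ?_, ?_⟩
  · have e := congrArg (fun p => aeval T p v) hab
    simp only [map_add, map_one, LinearMap.add_apply, Module.End.one_apply] at e
    rw [add_comm] at e
    exact e.symm
  · rw [LinearMap.mem_ker, ← Module.End.mul_apply, ← map_mul,
      show h * (b * h') = b * (h * h') by ring, map_mul, Module.End.mul_apply, hzero, LinearMap.zero_apply, map_zero]
  · rw [LinearMap.mem_ker, ← Module.End.mul_apply, ← map_mul,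
      show h' * (a * h) = a * (h * h') by ring, map_mul, Module.End.mul_apply, hzero, LinearMap.zero_apply, map_zero]

end general

section isometry
variable {F : Type*} [Field F] {ι : Type*} [Fintype ι]

/-- **powers of an isometry of finite order**: `⟨T^k v, w⟩ = ⟨v, (T^{N-1})^k w⟩` -/
lemma pow_dotProduct_of_isometry (T : (ι → F) →ₗ[F] (ι → F)) (hiso : ∀ v w, T v ⬝ᵥ T w = v ⬝ᵥ w)
    {N : ℕ} (hN : 0 < N) (hTN : T ^ N = 1) (k : ℕ) (v w : ι → F) :
    (T ^ k) v ⬝ᵥ w = v ⬝ᵥ ((T ^ (N - 1)) ^ k) w := by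
  have base : ∀ v w : ι → F, T v ⬝ᵥ w = v ⬝ᵥ (T ^ (N - 1)) w := by
    intro v w
    have e : T ((T ^ (N - 1)) w) = w := by
      rw [← Module.End.mul_apply, ← pow_succ', Nat.sub_add_cancel hN, hTN, Module.End.one_apply]
    conv_lhs => rw [← e]
    exact hiso v _
  induction k generalizing v w with
  | zero => simp
  | succ k ih =>
    rw [pow_succ, Module.End.mul_apply, ih (T v) w, base, ← Module.End.mul_apply, ← pow_succ']

/-- **adjoint**: `⟨g(T) v, w⟩ = ⟨v, g(T^{N-1}) w⟩`, written with `g ∘ X^{N-1}` -/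
theorem aeval_dotProduct_of_isometry (T : (ι → F) →ₗ[F] (ι → F)) (hiso : ∀ v w, T v ⬝ᵥ T w = v ⬝ᵥ w)
    {N : ℕ} (hN : 0 < N) (hTN : T ^ N = 1) (g : F[X]) (v w : ι → F) :
    aeval T g v ⬝ᵥ w = v ⬝ᵥ aeval T (g.comp (X ^ (N - 1))) w := by
  rw [aeval_comp, map_pow, aeval_X, aeval_eq_sum_range, aeval_eq_sum_range, LinearMap.sum_apply,
    LinearMap.sum_apply, sum_dotProduct, dotProduct_sum]
  refine Finset.sum_congr rfl fun k _ => ?_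
  rw [LinearMap.smul_apply, LinearMap.smul_apply, smul_dotProduct, dotProduct_smul,
    pow_dotProduct_of_isometry T hiso hN hTN k v w]

/-- **orthogonality**: for coprime `h, h'` with `h` self-reciprocal, `ker h(T) ⊥ ker h'(T)` -/
theorem dotProduct_eq_zero_of_mem_ker_isometry (T : (ι → F) →ₗ[F] (ι → F))
    (hiso : ∀ v w, T v ⬝ᵥ T w = v ⬝ᵥ w) {N : ℕ} (hN : 0 < N) (hTN : T ^ N = 1) {h h' : F[X]}
    (hcop : IsCoprime h h') (hrec : h ∣ h.comp (X ^ (N - 1))) {u z : ι → F}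
    (hu : aeval T h u = 0) (hz : aeval T h' z = 0) : u ⬝ᵥ z = 0 := by
  obtain ⟨a, b, hab⟩ := hcop
  -- z = h(T) (a(T) z)
  have hz' : z = aeval T h (aeval T a z) := by
    have e := congrArg (fun p => aeval T p z) hab
    simp only [map_add, map_mul, map_one, LinearMap.add_apply, Module.End.mul_apply, Module.End.one_apply, hz,
      map_zero, add_zero] at e
    rw [← Module.End.mul_apply, ← map_mul, mul_comm, map_mul, Module.End.mul_apply]
    exact e.symm
  rw [hz', dotProduct_comm, aeval_dotProduct_of_isometry T hiso hN hTN h _ u]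
  obtain ⟨r, hr⟩ := hrec
  rw [hr, mul_comm h r, map_mul, Module.End.mul_apply, hu, map_zero, dotProduct_zero]

variable [DecidableEq ι]

/-- **Even multiplicity (Lander 1983, Prop. 3.18, semisimple cyclic case; kernel).**  An isometry `T` of the dot product on
`ι → F` with `T^N = 1` that leaves a self-dual code `C` invariant has every irreducible self-reciprocal factor `h` of
`X^N - 1` with even multiplicity: `2 · deg h ∣ dim ker h(T)`. -/
theorem two_mul_natDegree_dvd_finrank_ker (T : (ι → F) →ₗ[F] (ι → F)) (hiso : ∀ v w, T v ⬝ᵥ T w = v ⬝ᵥ w)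
    {N : ℕ} (hN : 0 < N) (hTN : T ^ N = 1) {h h' : F[X]} (hf : h * h' = X ^ N - 1) (hcop : IsCoprime h h')
    (hirr : Irreducible h) (hrec : h ∣ h.comp (X ^ (N - 1)))
    (C : Submodule F (ι → F)) (hCT : ∀ v ∈ C, T v ∈ C) (hC : ∀ v, v ∈ C ↔ ∀ c ∈ C, v ⬝ᵥ c = 0) :
    2 * h.natDegree ∣ Module.finrank F (LinearMap.ker (aeval T h)) := by
  set Vh := LinearMap.ker (aeval T h) with hVh
  set V' := LinearMap.ker (aeval T h') with hV'
  have hc : IsCompl Vh V' := isCompl_ker_aeval_of_pow_eq_one T hTN hf hcop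
  have hzero : aeval T (h * h') = 0 := by
    rw [hf, map_sub, map_pow, aeval_X, map_one, hTN, sub_self]
  obtain ⟨a, b, hab⟩ := hcop
  have hcop' : IsCoprime h h' := ⟨a, b, hab⟩
  -- orthogonality V_h ⊥ V'
  have horth : ∀ u ∈ Vh, ∀ z ∈ V', u ⬝ᵥ z = 0 := fun u hu z hz =>
    dotProduct_eq_zero_of_mem_ker_isometry T hiso hN hTN hcop' hrec (LinearMap.mem_ker.mp hu)
      (LinearMap.mem_ker.mp hz)
  -- U := C ∩ V_h
  set U : Submodule F (ι → F) := C ⊓ Vh with hU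
  have hU_C : ∀ u ∈ U, u ∈ C := fun u hu => (Submodule.mem_inf.mp hu).1
  have hU_V : ∀ u ∈ U, u ∈ Vh := fun u hu => (Submodule.mem_inf.mp hu).2
  -- components of a code word are code words
  have hsplit : ∀ c ∈ C, ∃ c₁ ∈ U, ∃ c₂ ∈ V', c = c₁ + c₂ := by
    intro c hcC
    obtain ⟨e, h1, h2⟩ := bezout_split T hab hzero c
    exact ⟨_, Submodule.mem_inf.mpr ⟨aeval_mem_of_invariant T C hCT _ hcC, h1⟩, _, h2, e⟩
  -- the dot product as a bilinear form
  set Bf : LinearMap.BilinForm F (ι → F) := Matrix.toBilin' (1 : Matrix ι ι F) with hBf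
  have hBf_apply : ∀ v w, Bf v w = v ⬝ᵥ w := by
    intro v w
    rw [hBf, Matrix.toBilin'_apply', Matrix.one_mulVec]
  have hBf_nd : Bf.Nondegenerate := by
    rw [hBf, LinearMap.BilinForm.nondegenerate_toBilin'_iff_det_ne_zero, Matrix.det_one]
    exact one_ne_zero
  -- U^⊥ = U ⊔ V'
  have hUorth : Bf.orthogonal U = U ⊔ V' := by
    apply le_antisymm
    · intro w hw
      rw [LinearMap.BilinForm.mem_orthogonal_iff] at hw
      have hw' : ∀ u ∈ U, u ⬝ᵥ w = 0 := fun u hu => by rw [← hBf_apply]; exact hw u hu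
      have hwtop : w ∈ Vh ⊔ V' := by rw [hc.sup_eq_top]; exact Submodule.mem_top
      obtain ⟨w₁, hw₁, w₂, hw₂, rfl⟩ := Submodule.mem_sup.mp hwtop
      refine Submodule.add_mem_sup (Submodule.mem_inf.mpr ⟨?_, hw₁⟩) hw₂
      rw [hC]
      intro c hcC
      obtain ⟨c₁, hc₁, c₂, hc₂, rfl⟩ := hsplit c hcC
      rw [dotProduct_add, horth w₁ hw₁ c₂ hc₂, add_zero]
      have e := hw' c₁ hc₁
      rw [dotProduct_add, horth c₁ (hU_V c₁ hc₁) w₂ hw₂, add_zero, dotProduct_comm] at e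
      exact e
    · rw [sup_le_iff]
      constructor
      · intro z hz
        rw [LinearMap.BilinForm.mem_orthogonal_iff]
        intro u hu
        show Bf u z = 0
        rw [hBf_apply]
        exact ((hC u).mp (hU_C u hu)) z (hU_C z hz)
      · intro w hw
        rw [LinearMap.BilinForm.mem_orthogonal_iff]
        intro u hu
        show Bf u w = 0
        rw [hBf_apply]
        exact horth u (hU_V u hu) w hw
  -- dimensions
  have hOrth := LinearMap.BilinForm.finrank_orthogonal hBf_nd U
  rw [hUorth] at hOrth
  have hUle : Module.finrank F U ≤ Module.finrank F (ι → F) := Submodule.finrank_le U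
  have hdisj : U ⊓ V' = ⊥ := by
    rw [eq_bot_iff]
    intro w hw
    rw [Submodule.mem_bot]
    have e : w ∈ Vh ⊓ V' := Submodule.mem_inf.mpr ⟨hU_V w (Submodule.mem_inf.mp hw).1, (Submodule.mem_inf.mp hw).2⟩
    rw [hc.inf_eq_bot, Submodule.mem_bot] at e
    exact e
  have hsup := Submodule.finrank_sup_add_finrank_inf_eq U V'
  rw [hdisj, finrank_bot, add_zero] at hsup
  have hVV' := Submodule.finrank_sup_add_finrank_inf_eq Vh V'
  rw [hc.sup_eq_top, hc.inf_eq_bot, finrank_top, finrank_bot, add_zero] at hVV'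
  -- deg h ∣ dim U
  have hUinv : ∀ u ∈ U, T u ∈ U := fun u hu =>
    Submodule.mem_inf.mpr ⟨hCT u (hU_C u hu), mem_ker_aeval_of_mem_ker T h (hU_V u hu)⟩
  have hdvdU : h.natDegree ∣ Module.finrank F U := by
    apply natDegree_dvd_finrank_of_aeval_eq_zero (T.restrict hUinv) hirr
    have hcomp : U.subtype ∘ₗ T.restrict hUinv = T ∘ₗ U.subtype := LinearMap.ext fun v => rfl
    refine LinearMap.ext fun v => Subtype.ext ?_
    have e := aeval_apply_of_comp_eq (T.restrict hUinv) T U.subtype hcomp h v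
    rw [Submodule.subtype_apply] at e
    rw [e, LinearMap.zero_apply, Submodule.coe_zero, Submodule.subtype_apply]
    exact LinearMap.mem_ker.mp (hU_V _ v.2)
  -- arithmetic
  obtain ⟨r, hr⟩ := hdvdU
  refine ⟨r, ?_⟩
  have hdim : Module.finrank F Vh = 2 * Module.finrank F U := by omega
  rw [hdim, hr]
  ring

/-- The same with the coprime complementary factor supplied by separability of `X^N - 1` (`N ≠ 0` in `F`). -/
theorem two_mul_natDegree_dvd_finrank_ker' (T : (ι → F) →ₗ[F] (ι → F)) (hiso : ∀ v w, T v ⬝ᵥ T w = v ⬝ᵥ w)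
    {N : ℕ} (hN : 0 < N) (hNF : (N : F) ≠ 0) (hTN : T ^ N = 1) {h : F[X]} (hdvd : h ∣ X ^ N - 1)
    (hirr : Irreducible h) (hrec : h ∣ h.comp (X ^ (N - 1)))
    (C : Submodule F (ι → F)) (hCT : ∀ v ∈ C, T v ∈ C) (hC : ∀ v, v ∈ C ↔ ∀ c ∈ C, v ⬝ᵥ c = 0) :
    2 * h.natDegree ∣ Module.finrank F (LinearMap.ker (aeval T h)) := by
  obtain ⟨h', hh'⟩ := hdvd
  have hsep : (X ^ N - 1 : F[X]).Separable := by
    have := separable_X_pow_sub_C (1 : F) hNF one_ne_zero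
    simpa using this
  rw [hh'] at hsep
  exact two_mul_natDegree_dvd_finrank_ker T hiso hN hTN hh'.symm hsep.isCoprime hirr hrec C hCT hC

end isometry

end Summit.Ventures.DiscreteObjects.Hadamard
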